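/-
Copyright (c) 2026 the pub-hodgecm-mathlib formalisation cell (harness21).  Prover seat hodgecm-mathlib-K2E1-p04 (g2), Track B ∕ K2-LIT
(build stream 29), h413 = `stmt-HodgeConjecture-24833`, line `K2_E1_TraceFormulaBeta`; BY-NAME DEAL of the dealer K2E1-plan (g0)
2026-09-03T22:23:49Z: `Theorems/K2E1SupercuspidalJacquetVanishingU2.lean` (item (ii): Harish-Chandra's criterion ⇒ for `U(Φ₂)`).
-/
import Summits.HodgeConjecture.HodgeConjecture.Theorems.K2E1UnitaryTwoTorusContraction   -- ★ satellite 1∕2 (general-rank averaging∕projector; rank-two torus family + escape)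
import HarnessLib

/-!
# K2·E1 — `K2E1SupercuspidalJacquetVanishingU2`: HARISH-CHANDRA'S CRITERION ⇒ FOR THE QUASI-SPLIT `U(Φ₂) = U(1,1)`: a supercuspidal representation
# (compact-mod-centre coefficients) has VANISHING JACQUET MODULE along the Borel — the Φ₂ twin of ★ `U3SupercuspidalJacquetVanishing`

Track B ∕ K2-LIT, crux h413 = `stmt-HodgeConjecture-24833`, route of record `HCCMUnconditional`; cell `hodgecm-mathlib`, squad K2; prover seat
`hodgecm-mathlib-K2E1-p04` (g2), BY-NAME DEAL of the dealer K2E1-plan (g0) 2026-09-03T22:23:49Z, item (ii); lane `--supports stmt-HodgeConjecture-24833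
--as helper` (count-neutral).  THEOREMS ONLY (no `def`, no `instance`, no notation, no named-fact hypothesis, no `sorry`).

THE MATHEMATICS [Casselman1995 Thm. 5.3.1 (a)⇒(c), Prop. 1.4.4; BernsteinZelevinsky1976 Thm. 3.21; HarishChandra1970 Part I §3; Rogawski1990 §12.2 p. 173
«An element of `E(G)` is either supercuspidal or a constituent of an induced representation `i_G(χ)`», here for `H = U(2)`]: Casselman's Haar-free
argument, VERBATIM the tree's Φ₃ proof (★ `UnitaryGroup.coinvariants_subsingleton_of_isSupercuspidal`) with the rank-two torus `a_N = d(ϖ^N, ϖ^{-N})`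
(★ satellite `K2E1UnitaryTwoTorusContraction.exists_torusU_family_two`): if `[v₀] ≠ 0` in `V_N`, fix `K_γ ∩ U` stabilising `v₀` (`γ < 1`), the projector `e`
onto `V^{K_γ ∩ U}` (★ `IsSmooth.exists_fixedPoints_projection`), the injective action `T` of `a_1` on `V_N` and a linear form `μ` with `μ(T^N [v₀]) ≠ 0`
infinitely often (★ `exists_dual_forall_exists_apply_pow_ne_zero`); the smooth form `φ = μ ∘ [·] ∘ e` satisfies `φ(ρ(a_N) v₀) = μ(T^N [v₀])` by the averaging
step (★ satellite `coinvariants_mk_projector_apply_eq_of_unitaryCongruence`: Iwahori factorisation of `K_γ ∩ U` + contraction), whereas `a_N ∉ C · Z(U)` for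
large `N` (★ satellite `exists_forall_torusTwo_not_mem_mul_of_forall_eq_scalar`).  Irreducibility and admissibility are not used.

* §1 **`coinvariants_subsingleton_of_isSupercuspidal_two`** — the model `U(σ, Φ₂)(K)` over a non-archimedean local field `K` with continuous `σ`, scalar
  centre, and a `σ`-fixed `ϖ ≠ 0` with `|ϖ| < 1`: every SMOOTH SUPERCUSPIDAL `ρ` has `Subsingleton` `N`-coinvariants along ★ `borelTriple σ Φ₂`.
* §2 the CM instance at a NON-SPLIT place: `localNonsplitEquiv_symm_mem_cmBorelTriple_N_two` (the one-place model ★ `localNonsplitEquiv` matches the unipotent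
  radicals, Φ₂ twin of the ★ Φ₃ lemma) and **`cm_coinvariants_subsingleton_of_isSupercuspidal_two`**: for a CM field `L`, a finite place `v` of `L⁺`
  non-split in `L`, and a smooth supercuspidal `ρ` of `U(Φ₂)(L⁺_v) = (cmDatum L 2 Φ₂).Local v`: the Jacquet module along ★ `cmBorelTriple L 2 v` vanishes
  (transport along the model; centre scalar by ★ `exists_coe_eq_scalar_of_mem_center_unitaryGroupOfForm`; `ϖ := y σ_w(y)` for a uniformiser `y` of `L_w`).
* §3 the bridge to the hypothesis `hJ` of ★ p855253 `K2E1SupercuspidalCoefficientNCuspidal`: `forall_mem_span_of_subsingleton_coinvariants`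
  (`Subsingleton V_N ⇒ V = ⟨ρ(n)x − x : n ∈ N⟩`) and **`cm_forall_mem_span_sub_of_isSupercuspidal_two`** (= `hJ` DISCHARGED for `U(Φ₂)(L⁺_v)` at non-split `v`).
The exhaustion `Nj` and the unconditional corollary (iii) are in the companion file `K2E1UnipotentExhaustionU2`.

HONEST LABEL: HC_CM is proved only modulo the 7 printed citations (2 remaining named inputs: hLiu418 = `stmt-HodgeConjecture-24832`, h413 =
`stmt-HodgeConjecture-24833`) until rung 0 closes; this file moves no counter.

## References
* [Casselman1995] W. Casselman, *Introduction to the theory of admissible representations of p-adic reductive groups* (1995), Prop. 1.4.4, Thm. 5.3.1.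
* [BernsteinZelevinsky1976] I. N. Bernstein, A. V. Zelevinsky, *Representations of the group GL(n, F)*, Russian Math. Surveys 31:3 (1976), Thm. 3.21.
* [HarishChandra1970] Harish-Chandra (notes by G. van Dijk), *Harmonic analysis on reductive p-adic groups*, LNM 162 (1970), Part I §3.
* [Rogawski1990] J. D. Rogawski, *Automorphic Representations of Unitary Groups in Three Variables*, Ann. of Math. Stud. 123 (1990), §1.10 p. 9, §12.2 p. 173,
  §13.8 p. 218 (i)–(iii).
* [PlatonovRapinchuk1994] V. Platonov, A. Rapinchuk, *Algebraic Groups and Number Theory* (1994), §5.1.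
-/

set_option autoImplicit false
-- the mandated namespace repeats the single-problem summit's segment (`HodgeConjecture.HodgeConjecture`)
set_option linter.dupNamespace false

open scoped MatrixGroups Pointwise Topology
open ValuativeRel Matrix
open Literature.NumberTheory.Automorphic Literature.NumberTheory.Automorphic.UnitaryGroup
open Summit.HodgeConjecture.HodgeConjecture.Cruxes.H413.K2E1UnitaryTwoTorusContraction

namespace Summit.HodgeConjecture.HodgeConjecture.Cruxes.H413.K2E1SupercuspidalJacquetVanishingU2

/-! ## §1 Harish-Chandra's criterion ⇒ for the model `U(σ, Φ₂)(K)` over a non-archimedean local field -/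

section Model

variable {K : Type*} [Field K] [ValuativeRel K] [TopologicalSpace K] [IsNonarchimedeanLocalField K]
  (σ : K →+* K) {J : Matrix (Fin 2) (Fin 2) K} (hJ : J = (StdForm.antidiagonal 2).over K)
  {V : Type*} [AddCommGroup V] [Module ℂ V]

omit [ValuativeRel K] [TopologicalSpace K] [IsNonarchimedeanLocalField K] in
/-- Iterating the torus action on the Jacquet module (local copy, general rank, of ★ `UnitaryGroup.jacquetModule_pow_mk` whose statement is `Fin 3`):
for a multiplicative family `a` in `M`, `(r_B(a_1))^N [x] = [ρ(a_N) x]` (★ `Representation.jacquetModule_mk`). [cite: BernsteinZelevinsky1977, §1.8] -/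
private theorem jacquetModule_pow_mk' {n : ℕ} {J' : Matrix (Fin n) (Fin n) K} (hJ' : J' = (StdForm.antidiagonal n).over K)
    {a : ℕ → ↥(unitaryGroupOfForm σ J')} (ha_succ : ∀ N, a (N + 1) = a N * a 1) (ha_zero : a 0 = 1)
    (haM : ∀ N, a N ∈ (borelTriple σ J' hJ').M) (ρ : Representation ℂ ↥(unitaryGroupOfForm σ J') V) (N : ℕ) (x : V) :
    (ρ.jacquetModule (borelTriple σ J' hJ') ⟨a 1, haM 1⟩ ^ N) (Representation.Coinvariants.mk ((borelTriple σ J' hJ').restrict ρ) x) =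
      Representation.Coinvariants.mk ((borelTriple σ J' hJ').restrict ρ) (ρ (a N) x) := by
  induction N generalizing x with
  | zero => rw [pow_zero, Module.End.one_apply, ha_zero, MonoidHom.map_one, Module.End.one_apply]
  | succ N ih =>
    rw [pow_succ, Module.End.mul_apply]
    have h1 : ρ.jacquetModule (borelTriple σ J' hJ') ⟨a 1, haM 1⟩ (Representation.Coinvariants.mk ((borelTriple σ J' hJ').restrict ρ) x) =
        Representation.Coinvariants.mk ((borelTriple σ J' hJ').restrict ρ) (ρ (a 1) x) :=
      Representation.jacquetModule_mk ρ (borelTriple σ J' hJ') ⟨a 1, haM 1⟩ x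
    have h2 : ρ (a N) (ρ (a 1) x) = ρ (a (N + 1)) x := by
      rw [ha_succ N, MonoidHom.map_mul, Module.End.mul_apply]
    rw [h1, ih, h2]

/-- **HARISH-CHANDRA'S CRITERION, DIRECTION ⇒, FOR THE QUASI-SPLIT `U(1,1) = U(σ, Φ₂)(K)` OVER A NON-ARCHIMEDEAN LOCAL FIELD.**  `σ` continuous, the centre of
`U = U(σ, Φ₂)(K)` scalar, `ϖ ≠ 0` `σ`-fixed with `|ϖ| < 1`; then every SMOOTH SUPERCUSPIDAL representation `ρ` of `U` (★ `Representation.IsSupercuspidal`: all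
smooth matrix coefficients supported in `C · Z(U)`, `C` compact) has VANISHING JACQUET MODULE along the Borel triple ★ `borelTriple σ Φ₂`: the `N`-coinvariants are
a subsingleton.  Proof = ★ `UnitaryGroup.coinvariants_subsingleton_of_isSupercuspidal` (Φ₃) with the rank-two torus family (adapted verbatim). [cite: Casselman1995, Thm. 5.3.1, Prop. 1.4.4] [cite: BernsteinZelevinsky1976, Thm. 3.21] [cite: HarishChandra1970, Part I §3]
[cite: Rogawski1990, §12.2 p. 173] -/
theorem coinvariants_subsingleton_of_isSupercuspidal_two (hσc : Continuous σ)
    (hZ : ∀ z ∈ Subgroup.center ↥(unitaryGroupOfForm σ J), ∃ u : Kˣ,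
      ((z : ↥(unitaryGroupOfForm σ J)) : GL (Fin 2) K) = Matrix.GeneralLinearGroup.scalar (Fin 2) u)
    {ϖ : K} (hϖ0 : ϖ ≠ 0) (hϖ1 : valuation K ϖ < 1) (hσϖ : σ ϖ = ϖ)
    (ρ : Representation ℂ ↥(unitaryGroupOfForm σ J) V) (hρ : ρ.IsSmooth) (hsc : ρ.IsSupercuspidal) :
    Subsingleton ((borelTriple σ J hJ).restrict ρ).Coinvariants := by
  classical
  haveI : T2Space K := (Literature.NumberTheory.GaloisRepresentations.IsNonarchimedeanLocalField.isLocalField K).toT2Space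
  by_contra hne
  -- a vector with non-zero image in the Jacquet module
  obtain ⟨v₀, hw₀⟩ : ∃ v₀ : V, Representation.Coinvariants.mk ((borelTriple σ J hJ).restrict ρ) v₀ ≠ 0 := by
    by_contra h
    push Not at h
    exact hne ⟨fun x y => by
      obtain ⟨a, rfl⟩ := Representation.Coinvariants.mk_surjective _ x
      obtain ⟨b, rfl⟩ := Representation.Coinvariants.mk_surjective _ y
      rw [h a, h b]⟩
  -- a principal congruence trace `K_γ ∩ U`, `γ < 1`, fixing `v₀`
  have hstab : IsOpen (ρ.stabilizerSubgroup v₀ : Set ↥(unitaryGroupOfForm σ J)) := hρ v₀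
  obtain ⟨U₀, hU₀, hU₀eq⟩ := isOpen_induced_iff.1 hstab
  have hU₀nhds : U₀ ∈ 𝓝 (1 : GL (Fin 2) K) := hU₀.mem_nhds (by
    have h1 : (1 : ↥(unitaryGroupOfForm σ J)) ∈ (Subtype.val ⁻¹' U₀ : Set ↥(unitaryGroupOfForm σ J)) := by
      rw [hU₀eq]; exact Subgroup.one_mem _
    exact h1)
  obtain ⟨γ₁, hγ₁⟩ := exists_congruenceGL_subset (n := 2) hU₀nhds
  have hvϖ0 : valuation K ϖ ≠ 0 := (Valuation.ne_zero_iff _).2 hϖ0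
  obtain ⟨γ, hγle, hγlt⟩ : ∃ γ : (ValueGroupWithZero K)ˣ, (γ : ValueGroupWithZero K) ≤ γ₁ ∧ (γ : ValueGroupWithZero K) < 1 :=
    ⟨min γ₁ (Units.mk0 (valuation K ϖ) hvϖ0), Units.val_le_val.2 (min_le_left _ _),
      lt_of_le_of_lt (Units.val_le_val.2 (min_le_right γ₁ (Units.mk0 (valuation K ϖ) hvϖ0))) (by rw [Units.val_mk0]; exact hϖ1)⟩
  have hKfix : ∀ g ∈ (congruenceGL 2 (γ : ValueGroupWithZero K)).comap (unitaryGroupOfForm σ J).subtype, ρ g v₀ = v₀ := by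
    intro g hg
    have hg' : (g : GL (Fin 2) K) ∈ U₀ := hγ₁ (congruenceGL_mono hγle hg)
    have h2 : g ∈ (Subtype.val ⁻¹' U₀ : Set ↥(unitaryGroupOfForm σ J)) := hg'
    rw [hU₀eq] at h2
    exact (ρ.mem_stabilizerSubgroup v₀ g).1 h2
  obtain ⟨hKc, hKo⟩ := isCompact_isOpen_unitaryCongruence σ (J := J) hσc (Units.ne_zero γ)
  -- the projector onto the `K_γ ∩ U`-fixed vectors
  obtain ⟨e, -, he₂, he₃⟩ := hρ.exists_fixedPoints_projection hKc
  -- the torus elements `a N = d(ϖ^N, ϖ^{-N})` and the action `T` of `a 1` on the Jacquet module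
  obtain ⟨a, ha, ha_succ, ha_zero, haM, haE_anti⟩ := exists_torusU_family_two σ hJ hϖ0 hσϖ
  obtain ⟨T, hT1⟩ : ∃ T : ((borelTriple σ J hJ).restrict ρ).Coinvariants →ₗ[ℂ] ((borelTriple σ J hJ).restrict ρ).Coinvariants,
      T = ρ.jacquetModule (borelTriple σ J hJ) ⟨a 1, haM 1⟩ := ⟨_, rfl⟩
  have hTq : ∀ (N : ℕ) (x : V), (T ^ N) (Representation.Coinvariants.mk ((borelTriple σ J hJ).restrict ρ) x) =
      Representation.Coinvariants.mk ((borelTriple σ J hJ).restrict ρ) (ρ (a N) x) := by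
    intro N x
    rw [hT1]
    exact jacquetModule_pow_mk' σ hJ ha_succ ha_zero haM ρ N x
  have hTinj : Function.Injective T := by
    rw [hT1]; exact ((ρ.jacquetModule (borelTriple σ J hJ)).apply_bijective _).1
  obtain ⟨μ, hμ⟩ := exists_dual_forall_exists_apply_pow_ne_zero T hTinj hw₀
  -- the smooth linear form `φ = μ ∘ [·] ∘ e`
  obtain ⟨φ, hφdef⟩ : ∃ φ : Module.Dual ℂ V, φ = μ ∘ₗ Representation.Coinvariants.mk ((borelTriple σ J hJ).restrict ρ) ∘ₗ e :=
    ⟨_, rfl⟩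
  have hφinv : ∀ g ∈ (congruenceGL 2 (γ : ValueGroupWithZero K)).comap (unitaryGroupOfForm σ J).subtype, ρ.dual g φ = φ := by
    intro g hg
    ext x
    simp only [hφdef, Representation.dual_apply, Module.Dual.transpose_apply, LinearMap.comp_apply]
    rw [he₃ _ (Subgroup.inv_mem _ hg)]
  have hφmem : φ ∈ ρ.contragredient :=
    ρ.dual.isSmoothVector_of_le hKo fun g hg => by
      rw [Representation.mem_stabilizerSubgroup]
      exact hφinv g hg
  obtain ⟨C, hC, hsupp⟩ := hsc φ hφmem v₀
  -- escape: `a N ∉ C · Z(U)` for `N` large, read in `GL₂(K)`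
  have hZ' : ∀ z ∈ (Subtype.val '' (Subgroup.center ↥(unitaryGroupOfForm σ J) : Set ↥(unitaryGroupOfForm σ J)) : Set (GL (Fin 2) K)),
      ∃ u : Kˣ, z = Matrix.GeneralLinearGroup.scalar (Fin 2) u := by
    rintro z ⟨z', hz', rfl⟩
    exact hZ z' hz'
  obtain ⟨N₀, hN₀⟩ := exists_forall_torusTwo_not_mem_mul_of_forall_eq_scalar hϖ0 hϖ1 (hC.image continuous_subtype_val) hZ'
  obtain ⟨N, hN, hμN⟩ := hμ N₀
  refine hN₀ N hN ?_
  rw [← ha]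
  -- `a N ∈ supp φ(ρ(·) v₀) ⊆ C · Z(U)`
  have hmem : a N ∈ C * (Subgroup.center ↥(unitaryGroupOfForm σ J) : Set ↥(unitaryGroupOfForm σ J)) := by
    refine hsupp ?_
    rw [Function.mem_support, Representation.matrixCoeff_apply, hφdef, LinearMap.comp_apply, LinearMap.comp_apply,
      coinvariants_mk_projector_apply_eq_of_unitaryCongruence σ hJ hσc hγlt hϖ0 hϖ1.le (haE_anti N) (a N) (ha N) ρ hρ hKfix e he₂ he₃, ← hTq N v₀]
    exact hμN
  obtain ⟨c, hc, z, hz, hcz⟩ := Set.mem_mul.1 hmem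
  refine Set.mem_mul.2 ⟨(c : GL (Fin 2) K), Set.mem_image_of_mem _ hc, (z : GL (Fin 2) K), Set.mem_image_of_mem _ hz, ?_⟩
  rw [← Subgroup.coe_mul, hcz]

end Model

/-! ## §2 The CM instance: `U(Φ₂)(L⁺_v)` at a non-split place -/

section CM

open NumberField IsDedekindDomain

variable (L : Type) [Field L] [NumberField L] [IsCMField L]

/-- At a non-split `v` (one place `w` above it) the inverse of the one-place model ★ `localNonsplitEquiv` sends the upper unitriangular subgroup of
`U(σ_w, Φ₂)(L_w)` into the unipotent radical `N` of the Borel of `U(Φ₂)(L⁺_v)` (entries are read at the unique place `w`; Φ₂ twin of ★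
`UnitaryGroup.localNonsplitEquiv_symm_mem_cmBorelTriple_N`). [cite: PlatonovRapinchuk1994, §5.1] [cite: Rogawski1990, §1.10 p. 9] -/
theorem localNonsplitEquiv_symm_mem_cmBorelTriple_N_two (v : HeightOneSpectrum (𝓞 ↥(maximalRealSubfield L)))
    (w : PlacesOver L v) (hw : IsCMField.complexConj L • w.1 = w.1)
    {n : ↥(unitaryGroupOfForm (galAdicCompletionMap (L := L) (IsCMField.complexConj L) hw)
      (placeForm (Matrix.of fun i j : Fin 2 => if i.val + j.val + 1 = 2 then (1 : L) else 0) w.1))}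
    (hn : n ∈ unipotentU (galAdicCompletionMap (L := L) (IsCMField.complexConj L) hw)
      (placeForm (Matrix.of fun i j : Fin 2 => if i.val + j.val + 1 = 2 then (1 : L) else 0) w.1)) :
    (localNonsplitEquiv (IsCMField.complexConj L) (Matrix.of fun i j : Fin 2 => if i.val + j.val + 1 = 2 then (1 : L) else 0)
        (IsCMField.complexConj_ne_one L) w hw).symm n ∈ (cmBorelTriple L 2 v).N := by
  haveI : Subsingleton (PlacesOver L v) :=
    PlacesOver.subsingleton_of_smul_eq (IsCMField.complexConj L) (IsCMField.complexConj_ne_one L) w hw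
  have key : ∀ i j,
      ((((localNonsplitEquiv (IsCMField.complexConj L) (Matrix.of fun i j : Fin 2 => if i.val + j.val + 1 = 2 then (1 : L) else 0) (IsCMField.complexConj_ne_one L) w hw).symm n :
          «local» L (IsCMField.complexConj L) 2 (Matrix.of fun i j : Fin 2 => if i.val + j.val + 1 = 2 then (1 : L) else 0) v) : GL (Fin 2) (LocalRing L v)) :
            Matrix (Fin 2) (Fin 2) (LocalRing L v)) i j w =
        (((n : ↥(unitaryGroupOfForm (galAdicCompletionMap (L := L) (IsCMField.complexConj L) hw) (placeForm (Matrix.of fun i j : Fin 2 => if i.val + j.val + 1 = 2 then (1 : L) else 0) w.1))) :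
          GL (Fin 2) (w.1.adicCompletion L)) : Matrix (Fin 2) (Fin 2) (w.1.adicCompletion L)) i j := by
    intro i j
    have h := congr_fun (congr_fun (coe_localNonsplitEquiv_apply L (Matrix.of fun i j : Fin 2 => if i.val + j.val + 1 = 2 then (1 : L) else 0) v w hw
      ((localNonsplitEquiv (IsCMField.complexConj L) (Matrix.of fun i j : Fin 2 => if i.val + j.val + 1 = 2 then (1 : L) else 0) (IsCMField.complexConj_ne_one L) w hw).symm n)) i) j
    rw [ContinuousMulEquiv.apply_symm_apply, Matrix.map_apply, Pi.evalRingHom_apply] at h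
    exact h.symm
  obtain ⟨htri, hdiag⟩ := (mem_unipotentU_iff _).1 hn
  show (((localNonsplitEquiv (IsCMField.complexConj L) (Matrix.of fun i j : Fin 2 => if i.val + j.val + 1 = 2 then (1 : L) else 0) (IsCMField.complexConj_ne_one L) w hw).symm n :
      «local» L (IsCMField.complexConj L) 2 (Matrix.of fun i j : Fin 2 => if i.val + j.val + 1 = 2 then (1 : L) else 0) v) : GL (Fin 2) (LocalRing L v)) ∈ upperUnitriangular (Fin 2) (LocalRing L v)
  rw [mem_upperUnitriangular_iff]
  refine ⟨fun i j hij => ?_, fun i => ?_⟩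
  · funext w'
    obtain rfl : w' = w := Subsingleton.elim _ _
    rw [key, htri hij]
    rfl
  · funext w'
    obtain rfl : w' = w := Subsingleton.elim _ _
    rw [key, hdiag i]
    rfl

/-- **HARISH-CHANDRA'S CRITERION ⇒ FOR `U(Φ₂)(L⁺_v)` AT A NON-SPLIT PLACE.**  For a CM field `L`, a finite place `v` of `L⁺` that does not split in `L`, and a
SMOOTH SUPERCUSPIDAL representation `ρ` of `U(Φ₂)(L⁺_v) = (cmDatum L 2 Φ₂).Local v` (★ `cmDatum_Local_eq`), the Jacquet module of `ρ` along the Borel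
`B = T N` (★ `cmBorelTriple L 2 v`) VANISHES.  Transport to the one-place model `U(σ_w, Φ₂)(L_w)` (★ `localNonsplitEquiv`; centre = scalars, ★
`exists_coe_eq_scalar_of_mem_center_unitaryGroupOfForm`; the `σ_w`-fixed element `y σ_w(y)` of a uniformiser `y` of `L_w` has valuation `< 1`), apply §1, and
pull the vanishing back (★ `ParabolicTriple.subsingleton_coinvariants_of_comp`) — the Φ₂ twin of ★ `Rogawski1990.u3_isSupercuspidal_iff_jacquet_eq_zero_mp`.
[cite: Rogawski1990, §12.2 p. 173; §1.10 p. 9] [cite: Casselman1995, Thm. 5.3.1] [cite: BernsteinZelevinsky1976, Thm. 3.21] [cite: HarishChandra1970, Part I §3] -/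
theorem cm_coinvariants_subsingleton_of_isSupercuspidal_two
    (v : HeightOneSpectrum (𝓞 ↥(maximalRealSubfield L))) (hns : ∀ w : PlacesOver L v, IsCMField.complexConj L • w.1 = w.1)
    {V : Type*} [AddCommGroup V] [Module ℂ V]
    (ρ : Representation ℂ ((cmDatum L 2 (Matrix.of fun i j : Fin 2 => if i.val + j.val + 1 = 2 then (1 : L) else 0)).Local v) V)
    (hρ : ρ.IsSmooth) (hsc : ρ.IsSupercuspidal) :
    Subsingleton ((cmBorelTriple L 2 v).restrict ρ).Coinvariants := by
  classical
  obtain ⟨w⟩ := (inferInstance : Nonempty (PlacesOver L v))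
  have hw := hns w
  haveI : CharZero (w.1.adicCompletion L) := charZero_of_injective_algebraMap (algebraMap L (w.1.adicCompletion L)).injective
  -- the one-place model `e : U(Φ₂)(L⁺_v) ≃ₜ* U(σ_w, Φ₂)(L_w)` and its data
  obtain ⟨e, he⟩ : ∃ e : (cmDatum L 2 (Matrix.of fun i j : Fin 2 => if i.val + j.val + 1 = 2 then (1 : L) else 0)).Local v ≃ₜ*
      ↥(unitaryGroupOfForm (galAdicCompletionMap (L := L) (IsCMField.complexConj L) hw) (placeForm (Matrix.of fun i j : Fin 2 => if i.val + j.val + 1 = 2 then (1 : L) else 0) w.1)),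
      e = localNonsplitEquiv (IsCMField.complexConj L) (Matrix.of fun i j : Fin 2 => if i.val + j.val + 1 = 2 then (1 : L) else 0) (IsCMField.complexConj_ne_one L) w hw := ⟨_, rfl⟩
  have hJw : placeForm (Matrix.of fun i j : Fin 2 => if i.val + j.val + 1 = 2 then (1 : L) else 0) w.1 = (StdForm.antidiagonal 2).over (w.1.adicCompletion L) := by
    rw [placeForm, antidiagOne_eq_over, StdForm.over_map]
  have hσσ : ∀ x, galAdicCompletionMap (L := L) (IsCMField.complexConj L) hw (galAdicCompletionMap (L := L) (IsCMField.complexConj L) hw x) = x :=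
    galAdicCompletionMap_galAdicCompletionMap_of_smul_eq (IsCMField.complexConj L) w (IsCMField.complexConj_ne_one L) hw
  have hherm : ((placeForm (Matrix.of fun i j : Fin 2 => if i.val + j.val + 1 = 2 then (1 : L) else 0) w.1).map (galAdicCompletionMap (L := L) (IsCMField.complexConj L) hw))ᵀ = placeForm (Matrix.of fun i j : Fin 2 => if i.val + j.val + 1 = 2 then (1 : L) else 0) w.1 :=
    placeForm_hermitian_of_smul_eq (IsCMField.complexConj L) w (Matrix.of fun i j : Fin 2 => if i.val + j.val + 1 = 2 then (1 : L) else 0) (antidiagOne_isHermitian L 2) hw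
  have hdet : (placeForm (Matrix.of fun i j : Fin 2 => if i.val + j.val + 1 = 2 then (1 : L) else 0) w.1).det ≠ 0 :=
    ((Matrix.isUnit_iff_isUnit_det _).1 (isUnit_placeForm_of_isUnit_det (isUnit_antidiagOne_det L 2) w.1)).ne_zero
  have hZ : ∀ z ∈ Subgroup.center ↥(unitaryGroupOfForm (galAdicCompletionMap (L := L) (IsCMField.complexConj L) hw) (placeForm (Matrix.of fun i j : Fin 2 => if i.val + j.val + 1 = 2 then (1 : L) else 0) w.1)),
      ∃ u : (w.1.adicCompletion L)ˣ, ((z : ↥(unitaryGroupOfForm (galAdicCompletionMap (L := L) (IsCMField.complexConj L) hw)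
        (placeForm (Matrix.of fun i j : Fin 2 => if i.val + j.val + 1 = 2 then (1 : L) else 0) w.1))) : GL (Fin 2) (w.1.adicCompletion L)) = Matrix.GeneralLinearGroup.scalar (Fin 2) u :=
    fun z hz => exists_coe_eq_scalar_of_mem_center_unitaryGroupOfForm (galAdicCompletionMap (L := L) (IsCMField.complexConj L) hw)
      (placeForm (Matrix.of fun i j : Fin 2 => if i.val + j.val + 1 = 2 then (1 : L) else 0) w.1) hσσ hherm hdet two_ne_zero three_ne_zero hz
  -- a `σ_w`-fixed element of valuation `< 1`: `y σ_w(y)` for a uniformiser `y` of `L_w`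
  obtain ⟨y, hy⟩ := exists_isUniformizingElement (F := w.1.adicCompletion L)
  have hσv : valuation (w.1.adicCompletion L) (galAdicCompletionMap (L := L) (IsCMField.complexConj L) hw y) = valuation (w.1.adicCompletion L) y := by
    have h := valued_galAdicCompletionMap (L := L) (IsCMField.complexConj L) hw y
    rw [le_antisymm_iff, ← Valuation.vle_iff_le (Valued.v : Valuation (w.1.adicCompletion L) _),
      ← Valuation.vle_iff_le (Valued.v : Valuation (w.1.adicCompletion L) _)] at h
    rw [le_antisymm_iff, ← Valuation.vle_iff_le (valuation (w.1.adicCompletion L)), ← Valuation.vle_iff_le (valuation (w.1.adicCompletion L))]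
    exact h
  have hϖ0 : y * galAdicCompletionMap (L := L) (IsCMField.complexConj L) hw y ≠ 0 :=
    mul_ne_zero hy.ne_zero ((map_ne_zero_iff _ (galAdicCompletionMap (L := L) (IsCMField.complexConj L) hw).injective).2 hy.ne_zero)
  have hϖ1 : valuation (w.1.adicCompletion L) (y * galAdicCompletionMap (L := L) (IsCMField.complexConj L) hw y) < 1 := by
    rw [map_mul, hσv]
    exact mul_lt_one_of_nonneg_of_lt_one_left zero_le hy.valuation_lt_one hy.valuation_lt_one.le
  have hσϖ : galAdicCompletionMap (L := L) (IsCMField.complexConj L) hw (y * galAdicCompletionMap (L := L) (IsCMField.complexConj L) hw y) =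
      y * galAdicCompletionMap (L := L) (IsCMField.complexConj L) hw y := by
    rw [map_mul, hσσ, mul_comm]
  -- the transported representation `ρ' = ρ ∘ e⁻¹` on the model: smooth and supercuspidal
  obtain ⟨ρ', hρ'def⟩ : ∃ ρ' : Representation ℂ
      ↥(unitaryGroupOfForm (galAdicCompletionMap (L := L) (IsCMField.complexConj L) hw) (placeForm (Matrix.of fun i j : Fin 2 => if i.val + j.val + 1 = 2 then (1 : L) else 0) w.1)) V,
      ρ' = ρ.comp (e.symm : _ →* (cmDatum L 2 (Matrix.of fun i j : Fin 2 => if i.val + j.val + 1 = 2 then (1 : L) else 0)).Local v) := ⟨_, rfl⟩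
  have hρ'app : ∀ g x, ρ' g x = ρ (e.symm g) x := fun g x => by rw [hρ'def]; rfl
  have hsc' : ρ'.IsSupercuspidal := by
    rw [hρ'def]
    exact hsc.comp_continuousMulEquiv e.symm
  have hρ' : ρ'.IsSmooth := by
    intro x
    rw [Representation.isSmoothVector_iff]
    have h := hρ x
    rw [Representation.isSmoothVector_iff] at h
    have heq : (ρ'.stabilizerSubgroup x : Set _) = e.symm ⁻¹' (ρ.stabilizerSubgroup x : Set ((cmDatum L 2 (Matrix.of fun i j : Fin 2 => if i.val + j.val + 1 = 2 then (1 : L) else 0)).Local v)) := by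
      ext g
      simp only [SetLike.mem_coe, Representation.mem_stabilizerSubgroup, Set.mem_preimage, hρ'app]
    rw [heq]
    exact h.preimage e.symm.continuous
  have main := coinvariants_subsingleton_of_isSupercuspidal_two (galAdicCompletionMap (L := L) (IsCMField.complexConj L) hw) hJw
    (continuous_galAdicCompletionMap (L := L) (IsCMField.complexConj L) hw) hZ hϖ0 hϖ1 hσϖ ρ' hρ' hsc'
  -- transport the vanishing back along the model: the model's `N`-relations are `N`-relations of `ρ`
  rw [hρ'def] at main
  exact ParabolicTriple.subsingleton_coinvariants_of_comp (cmBorelTriple L 2 v)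
    (borelTriple (galAdicCompletionMap (L := L) (IsCMField.complexConj L) hw) (placeForm (Matrix.of fun i j : Fin 2 => if i.val + j.val + 1 = 2 then (1 : L) else 0) w.1) hJw)
    (e.symm : ↥(unitaryGroupOfForm (galAdicCompletionMap (L := L) (IsCMField.complexConj L) hw) (placeForm (Matrix.of fun i j : Fin 2 => if i.val + j.val + 1 = 2 then (1 : L) else 0) w.1)) →* (cmDatum L 2 (Matrix.of fun i j : Fin 2 => if i.val + j.val + 1 = 2 then (1 : L) else 0)).Local v) ρ
    (fun n hn => by rw [he]; exact localNonsplitEquiv_symm_mem_cmBorelTriple_N_two L v w hw hn) main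

end CM

/-! ## §3 The bridge to the hypothesis `hJ` of ★ `K2E1SupercuspidalCoefficientNCuspidal`: `V_N = 0 ⇒ V = ⟨ρ(n)x − x⟩` -/

section Bridge

/-- **`Subsingleton V_N ⇒ every vector is a sum of `ρ(n)x − x`, `n ∈ N`** — the tree's Jacquet-module carrier is `(t.restrict ρ).Coinvariants` (Mathlib
`Representation.Coinvariants`: `V ⧸ ⟨ρ(n)x − x : n ∈ N ∩ P⟩`), whose kernel generators are among the `ρ(n)x − x`, `n ∈ t.N`.
[cite: BernsteinZelevinsky1977, §1.8] -/
theorem forall_mem_span_of_subsingleton_coinvariants {G V : Type*} [Group G] [AddCommGroup V] [Module ℂ V] (t : ParabolicTriple G)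
    (ρ : Representation ℂ G V) (h : Subsingleton (t.restrict ρ).Coinvariants) (w : V) :
    w ∈ Submodule.span ℂ (Set.range fun p : ↥t.N × V => ρ (p.1 : G) p.2 - p.2) := by
  have h0 : Representation.Coinvariants.mk (t.restrict ρ) w = 0 := Subsingleton.elim _ _
  rw [Representation.Coinvariants.mk_eq_zero] at h0
  refine Submodule.span_le.2 ?_ h0
  rintro _ ⟨⟨n, x⟩, rfl⟩
  exact Submodule.subset_span ⟨(⟨((n : ↥t.P) : G), Subgroup.mem_subgroupOf.1 n.2⟩, x), rfl⟩

open NumberField IsDedekindDomain in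
/-- **`hJ` OF ★ p855253 DISCHARGED for `U(Φ₂)(L⁺_v)` at a non-split place**: for a smooth supercuspidal `ρ` of `U(Φ₂)(L⁺_v)`, every vector lies in
`⟨ρ(n)x − x : n ∈ N_v⟩`, `N_v = (cmBorelTriple L 2 v).N` — the Jacquet-vanishing hypothesis of `K2E1SupercuspidalCoefficientNCuspidal.integral_idempotent_translate_eq_zero`
∕ `UnitaryGroup.integral_idempotent_translate_cmBorelN_eq_zero` read with `N := 2`. [cite: Casselman1995, Thm. 5.3.1] [cite: Rogawski1990, §12.2 p. 173] -/
theorem cm_forall_mem_span_sub_of_isSupercuspidal_two (L : Type) [Field L] [NumberField L] [IsCMField L]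
    (v : HeightOneSpectrum (𝓞 ↥(maximalRealSubfield L))) (hns : ∀ w : PlacesOver L v, IsCMField.complexConj L • w.1 = w.1)
    {V : Type*} [AddCommGroup V] [Module ℂ V]
    (ρ : Representation ℂ ↥(unitaryGroupOfForm (conjLocal L (IsCMField.complexConj L) v) (cmLocalForm L 2 v)) V)
    (hρ : ρ.IsSmooth) (hsc : ρ.IsSupercuspidal) (w : V) :
    w ∈ Submodule.span ℂ (Set.range fun p : ↥(cmBorelTriple L 2 v).N × V => ρ (p.1 : _) p.2 - p.2) :=
  forall_mem_span_of_subsingleton_coinvariants (cmBorelTriple L 2 v) ρ (cm_coinvariants_subsingleton_of_isSupercuspidal_two L v hns ρ hρ hsc) w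

end Bridge

end Summit.HodgeConjecture.HodgeConjecture.Cruxes.H413.K2E1SupercuspidalJacquetVanishingU2
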